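import Mathlib
import Summits.Ventures.HodgeRepro2.T5CompletionDegreeSum
import Summits.Ventures.HodgeRepro2.T5RamificationIndexGlobal

/-!
# THE PLACE TRICHOTOMY OF A QUADRATIC EXTENSION AT A GIVEN PLACE: RAMIFIED / INERT / SPLIT (T5QuadraticPlaceCases)

For a quadratic extension of number fields `L/K`, a finite place `v` of `K` and a GIVEN place `w` of `L` above `v`,
the all-places sum `∑_{w' ∣ v} e(w'∣v) · f(w'∣v) = 2` (T5CompletionDegreeSum) leaves exactly three possibilities
(this is the POINTWISE form, at the place `w`; the EXISTENTIAL form over `v` — two distinct places, or a unique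
place with `(e, f) = (1, 2)` or `(2, 1)` — is seat p8's `T5QuadraticPlaceTrichotomy.quadratic_place_trichotomy`,
p412777, which this file does not restate):

* RAMIFIED: `e(w∣v) = 2`, `f(w∣v) = 1`, `w` is the only place above `v`;
* INERT: `e(w∣v) = 1`, `f(w∣v) = 2`, `w` is the only place above `v`;
* SPLIT: `e(w∣v) = 1`, `f(w∣v) = 1`, and there is a second place `w' ≠ w` above `v` (also with `e = f = 1`).

They are mutually exclusive (`trichotomy`), the product `g · e · f = 2` holds with `g` the number of places above `v`
(`card_mul_ramificationIdx'_mul_inertiaDeg'`), and `e(w∣v)`, `f(w∣v)` do not depend on the place `w` above `v`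
(`ramificationIdx'_eq`, `inertiaDeg'_eq` — the Galois-invariance of `e` and `f`, obtained here from the sum alone). In
the language of the local-field chain (rows 165–177: `ϖ` a uniformiser of `K_v`): ramified = `¬ Irreducible (alg ϖ)`,
inert = `Irreducible (alg ϖ) ∧ [L_w : K_v] = 2`, split = `[L_w : K_v] = 1` (`trichotomy_chain`).

No axiom beyond the standard trio; nothing of the scored record changes.
§8(d): uses an L-value-free non-vanishing device: NO.
-/

namespace Summit.Ventures.HodgeRepro2.T5QuadraticPlaceCases

open IsDedekindDomain HeightOneSpectrum NumberField

variable {K : Type*} [Field K] [NumberField K] (v : HeightOneSpectrum (NumberField.RingOfIntegers K))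
  {L : Type*} [Field L] [NumberField L] [Algebra K L] (w : HeightOneSpectrum (NumberField.RingOfIntegers L))
  [w.asIdeal.LiesOver v.asIdeal]

/-! ### `e · f ∈ {1, 2}` -/

/-- For a quadratic `L/K`: `e(w∣v) · f(w∣v) ≤ 2`. -/
theorem ramificationIdx'_mul_inertiaDeg'_le_two (hKL : Module.finrank K L = 2) :
    v.asIdeal.ramificationIdx' w.asIdeal * v.asIdeal.inertiaDeg' w.asIdeal ≤ 2 := by
  have h := Summit.Ventures.HodgeRepro2.T5CompletionDegree.finrank_le v w
  rw [Summit.Ventures.HodgeRepro2.T5CompletionFundamentalIdentity.finrank_eq_ramificationIdx'_mul_inertiaDeg' v w,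
    hKL] at h
  exact h

/-- For a quadratic `L/K`: `e(w∣v) · f(w∣v) = 1 ∨ e(w∣v) · f(w∣v) = 2`. -/
theorem ramificationIdx'_mul_inertiaDeg'_eq_one_or_two (hKL : Module.finrank K L = 2) :
    v.asIdeal.ramificationIdx' w.asIdeal * v.asIdeal.inertiaDeg' w.asIdeal = 1 ∨
      v.asIdeal.ramificationIdx' w.asIdeal * v.asIdeal.inertiaDeg' w.asIdeal = 2 := by
  have h1 := Summit.Ventures.HodgeRepro2.T5CompletionDegreeSum.one_le_ramificationIdx'_mul_inertiaDeg' v w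
  have h2 := ramificationIdx'_mul_inertiaDeg'_le_two v w hKL
  omega

/-- For a quadratic `L/K`: `e(w∣v) = 1 ∨ e(w∣v) = 2`. -/
theorem ramificationIdx'_eq_one_or_two (hKL : Module.finrank K L = 2) :
    v.asIdeal.ramificationIdx' w.asIdeal = 1 ∨ v.asIdeal.ramificationIdx' w.asIdeal = 2 := by
  have h1 := Summit.Ventures.HodgeRepro2.T5RamificationIndexGlobal.ramificationIdx'_le_finrank v w
  have h2 := Summit.Ventures.HodgeRepro2.T5RamificationIndexGlobal.ramificationIdx'_ne_zero v w
  rw [hKL] at h1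
  omega

/-- For a quadratic `L/K`: `f(w∣v) = 1 ∨ f(w∣v) = 2`. -/
theorem inertiaDeg'_eq_one_or_two (hKL : Module.finrank K L = 2) :
    v.asIdeal.inertiaDeg' w.asIdeal = 1 ∨ v.asIdeal.inertiaDeg' w.asIdeal = 2 := by
  have h1 := Summit.Ventures.HodgeRepro2.T5CompletionDegreeOne.inertiaDeg'_ne_zero v w
  have h2 := ramificationIdx'_mul_inertiaDeg'_le_two v w hKL
  have h3 := Summit.Ventures.HodgeRepro2.T5RamificationIndexGlobal.ramificationIdx'_ne_zero v w
  rcases Nat.lt_or_ge (v.asIdeal.inertiaDeg' w.asIdeal) 3 with h | h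
  · omega
  · exfalso
    have : 3 ≤ v.asIdeal.ramificationIdx' w.asIdeal * v.asIdeal.inertiaDeg' w.asIdeal :=
      le_trans h (Nat.le_mul_of_pos_left _ (Nat.pos_of_ne_zero h3))
    omega

/-- For a quadratic `L/K`: `e(w∣v)` and `f(w∣v)` are not both `2`. -/
theorem not_ramificationIdx'_eq_two_and_inertiaDeg'_eq_two (hKL : Module.finrank K L = 2) :
    ¬ (v.asIdeal.ramificationIdx' w.asIdeal = 2 ∧ v.asIdeal.inertiaDeg' w.asIdeal = 2) := by
  rintro ⟨he, hf⟩
  have h := ramificationIdx'_mul_inertiaDeg'_le_two v w hKL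
  rw [he, hf] at h
  omega

/-! ### The trichotomy -/

/-- THE PLACE TRICHOTOMY of a quadratic `L/K` at a place `w` above `v`: RAMIFIED (`e = 2, f = 1`, `w` unique above
`v`), or INERT (`e = 1, f = 2`, `w` unique above `v`), or SPLIT (`e = f = 1` and a second place `w' ≠ w` above `v`
with `e = f = 1`). -/
theorem trichotomy (hKL : Module.finrank K L = 2) :
    (v.asIdeal.ramificationIdx' w.asIdeal = 2 ∧ v.asIdeal.inertiaDeg' w.asIdeal = 1 ∧
        ∀ w' : HeightOneSpectrum (NumberField.RingOfIntegers L), w'.asIdeal.LiesOver v.asIdeal → w' = w) ∨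
      (v.asIdeal.ramificationIdx' w.asIdeal = 1 ∧ v.asIdeal.inertiaDeg' w.asIdeal = 2 ∧
        ∀ w' : HeightOneSpectrum (NumberField.RingOfIntegers L), w'.asIdeal.LiesOver v.asIdeal → w' = w) ∨
      (v.asIdeal.ramificationIdx' w.asIdeal = 1 ∧ v.asIdeal.inertiaDeg' w.asIdeal = 1 ∧
        ∃ w' : HeightOneSpectrum (NumberField.RingOfIntegers L), w' ≠ w ∧ w'.asIdeal.LiesOver v.asIdeal ∧
          v.asIdeal.ramificationIdx' w'.asIdeal = 1 ∧ v.asIdeal.inertiaDeg' w'.asIdeal = 1) := by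
  have hw187 :=
    Summit.Ventures.HodgeRepro2.T5CompletionFundamentalIdentity.finrank_eq_ramificationIdx'_mul_inertiaDeg' v w
  rcases ramificationIdx'_mul_inertiaDeg'_eq_one_or_two v w hKL with h | h
  · -- split
    right; right
    obtain ⟨he, hf⟩ := mul_eq_one.1 h
    refine ⟨he, hf, ?_⟩
    have h1 : Module.finrank (v.adicCompletion K) (w.adicCompletion L) = 1 := by rw [hw187, h]
    obtain ⟨w', hw', hne, hw'1⟩ :=
      Summit.Ventures.HodgeRepro2.T5CompletionDegreeSum.exists_ne_of_finrank_eq_one v hKL w h1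
    refine ⟨w', hne, hw', ?_⟩
    rw [Summit.Ventures.HodgeRepro2.T5CompletionFundamentalIdentity.finrank_eq_ramificationIdx'_mul_inertiaDeg' v w',
      mul_eq_one] at hw'1
    exact hw'1
  · -- unique place: ramified or inert
    have h2 : Module.finrank (v.adicCompletion K) (w.adicCompletion L) = 2 := by rw [hw187, h]
    have huniq := (Summit.Ventures.HodgeRepro2.T5CompletionDegreeSum.finrank_eq_two_iff_unique v hKL w).1 h2
    rcases ramificationIdx'_eq_one_or_two v w hKL with he | he
    · right; left
      refine ⟨he, ?_, huniq⟩
      rw [he, one_mul] at h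
      exact h
    · left
      refine ⟨he, ?_, huniq⟩
      rw [he] at h
      omega

/-- For a quadratic `L/K`: `g · e · f = 2`, with `g = S.card` the number of places above `v` and `e, f` taken at any
place `w` above `v`. -/
theorem card_mul_ramificationIdx'_mul_inertiaDeg' (hKL : Module.finrank K L = 2)
    (S : Finset (HeightOneSpectrum (NumberField.RingOfIntegers L)))
    (hS : ∀ w : HeightOneSpectrum (NumberField.RingOfIntegers L), w ∈ S ↔ w.asIdeal.LiesOver v.asIdeal) :
    S.card * (v.asIdeal.ramificationIdx' w.asIdeal * v.asIdeal.inertiaDeg' w.asIdeal) = 2 := by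
  rcases ramificationIdx'_mul_inertiaDeg'_eq_one_or_two v w hKL with h | h
  · rw [h, mul_one]
    have hall : ∀ w ∈ S, v.asIdeal.ramificationIdx' w.asIdeal * v.asIdeal.inertiaDeg' w.asIdeal = 1 := by
      intro x hx
      haveI := (hS x).1 hx
      rcases ramificationIdx'_mul_inertiaDeg'_eq_one_or_two v x hKL with hx1 | hx2
      · exact hx1
      · exfalso
        have hx2' : Module.finrank (v.adicCompletion K) (x.adicCompletion L) = 2 := by
          rw [Summit.Ventures.HodgeRepro2.T5CompletionFundamentalIdentity.finrank_eq_ramificationIdx'_mul_inertiaDeg'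
            v x, hx2]
        have hwx := Summit.Ventures.HodgeRepro2.T5CompletionDegreeSum.unique_of_finrank_eq_two v hKL x hx2' w
          inferInstance
        rw [hwx] at h
        omega
    exact (Summit.Ventures.HodgeRepro2.T5CompletionDegreeSum.card_eq_two_iff v hKL S hS).2 hall
  · rw [h, mul_two]
    have h1 : S.card = 1 :=
      (Summit.Ventures.HodgeRepro2.T5CompletionDegreeSum.card_eq_one_iff v hKL S hS).2
        ⟨w, (hS w).2 inferInstance, h⟩
    rw [h1]

/-- For a quadratic `L/K`: `e(w∣v) · f(w∣v)` does not depend on the place `w` above `v`. -/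
theorem ramificationIdx'_mul_inertiaDeg'_eq (hKL : Module.finrank K L = 2)
    (w' : HeightOneSpectrum (NumberField.RingOfIntegers L)) [w'.asIdeal.LiesOver v.asIdeal] :
    v.asIdeal.ramificationIdx' w.asIdeal * v.asIdeal.inertiaDeg' w.asIdeal =
      v.asIdeal.ramificationIdx' w'.asIdeal * v.asIdeal.inertiaDeg' w'.asIdeal := by
  obtain ⟨S, hS⟩ := Summit.Ventures.HodgeRepro2.T5CompletionDegreeSum.exists_finset_places_over (L := L) v
  have h1 := card_mul_ramificationIdx'_mul_inertiaDeg' v w hKL S hS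
  have h2 := card_mul_ramificationIdx'_mul_inertiaDeg' v w' hKL S hS
  have hpos : 0 < S.card := (Summit.Ventures.HodgeRepro2.T5CompletionDegreeSum.nonempty v S hS).card_pos
  exact Nat.eq_of_mul_eq_mul_left hpos (h1.trans h2.symm)

/-- For a quadratic `L/K`: `e(w∣v)` does not depend on the place `w` above `v`. -/
theorem ramificationIdx'_eq (hKL : Module.finrank K L = 2)
    (w' : HeightOneSpectrum (NumberField.RingOfIntegers L)) [w'.asIdeal.LiesOver v.asIdeal] :
    v.asIdeal.ramificationIdx' w.asIdeal = v.asIdeal.ramificationIdx' w'.asIdeal := by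
  have hef := ramificationIdx'_mul_inertiaDeg'_eq v w hKL w'
  rcases ramificationIdx'_mul_inertiaDeg'_eq_one_or_two v w hKL with h | h
  · -- both products are `1`, so both `e` are `1`
    obtain ⟨he, -⟩ := mul_eq_one.1 h
    rw [h] at hef
    obtain ⟨he', -⟩ := mul_eq_one.1 hef.symm
    rw [he, he']
  · -- `w` is the only place above `v`
    have h2 : Module.finrank (v.adicCompletion K) (w.adicCompletion L) = 2 := by
      rw [Summit.Ventures.HodgeRepro2.T5CompletionFundamentalIdentity.finrank_eq_ramificationIdx'_mul_inertiaDeg' v w,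
        h]
    have := Summit.Ventures.HodgeRepro2.T5CompletionDegreeSum.unique_of_finrank_eq_two v hKL w h2 w' inferInstance
    rw [this]

/-- For a quadratic `L/K`: `f(w∣v)` does not depend on the place `w` above `v`. -/
theorem inertiaDeg'_eq (hKL : Module.finrank K L = 2)
    (w' : HeightOneSpectrum (NumberField.RingOfIntegers L)) [w'.asIdeal.LiesOver v.asIdeal] :
    v.asIdeal.inertiaDeg' w.asIdeal = v.asIdeal.inertiaDeg' w'.asIdeal := by
  have hef := ramificationIdx'_mul_inertiaDeg'_eq v w hKL w'
  have he := ramificationIdx'_eq v w hKL w'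
  rw [he] at hef
  have hne := Summit.Ventures.HodgeRepro2.T5RamificationIndexGlobal.ramificationIdx'_ne_zero v w'
  exact Nat.eq_of_mul_eq_mul_left (Nat.pos_of_ne_zero hne) hef

/-! ### The trichotomy in the language of the local-field chain -/

/-- THE TRICHOTOMY IN CHAIN LANGUAGE (`ϖ` a uniformiser of `K_v`): RAMIFIED = `¬ Irreducible (alg ϖ)` (with
`[L_w : K_v] = 2` and `w` unique above `v`), INERT = `Irreducible (alg ϖ) ∧ [L_w : K_v] = 2` (with `w` unique above
`v`), SPLIT = `[L_w : K_v] = 1` (with `Irreducible (alg ϖ)` and a second place `w' ≠ w` above `v` of local degree `1`). -/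
theorem trichotomy_chain (hKL : Module.finrank K L = 2) {ϖ : v.adicCompletionIntegers K} (hϖ : Irreducible ϖ) :
    (¬ Irreducible (algebraMap (v.adicCompletionIntegers K) (w.adicCompletionIntegers L) ϖ) ∧
        Module.finrank (v.adicCompletion K) (w.adicCompletion L) = 2 ∧
        ∀ w' : HeightOneSpectrum (NumberField.RingOfIntegers L), w'.asIdeal.LiesOver v.asIdeal → w' = w) ∨
      (Irreducible (algebraMap (v.adicCompletionIntegers K) (w.adicCompletionIntegers L) ϖ) ∧
        Module.finrank (v.adicCompletion K) (w.adicCompletion L) = 2 ∧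
        ∀ w' : HeightOneSpectrum (NumberField.RingOfIntegers L), w'.asIdeal.LiesOver v.asIdeal → w' = w) ∨
      (Irreducible (algebraMap (v.adicCompletionIntegers K) (w.adicCompletionIntegers L) ϖ) ∧
        Module.finrank (v.adicCompletion K) (w.adicCompletion L) = 1 ∧
        ∃ (w' : HeightOneSpectrum (NumberField.RingOfIntegers L)) (_ : w'.asIdeal.LiesOver v.asIdeal), w' ≠ w ∧
          Module.finrank (v.adicCompletion K) (w'.adicCompletion L) = 1) := by
  have hw187 :=
    Summit.Ventures.HodgeRepro2.T5CompletionFundamentalIdentity.finrank_eq_ramificationIdx'_mul_inertiaDeg' v w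
  have hirr := Summit.Ventures.HodgeRepro2.T5RamificationIndexGlobal.irreducible_algebraMap_iff v w hϖ
  rcases trichotomy v w hKL with ⟨he, hf, huniq⟩ | ⟨he, hf, huniq⟩ | ⟨he, hf, -⟩
  · left
    refine ⟨?_, ?_, huniq⟩
    · rw [hirr, he]
      omega
    · rw [hw187, he, hf]
  · right; left
    refine ⟨hirr.2 he, ?_, huniq⟩
    rw [hw187, he, hf]
  · right; right
    have h1 : Module.finrank (v.adicCompletion K) (w.adicCompletion L) = 1 := by rw [hw187, he, hf]
    exact ⟨hirr.2 he, h1,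
      Summit.Ventures.HodgeRepro2.T5CompletionDegreeSum.exists_ne_of_finrank_eq_one v hKL w h1⟩

/-- RAMIFIED ⟹ unique place above `v` (quadratic `L/K`, chain language). -/
theorem unique_of_not_irreducible (hKL : Module.finrank K L = 2) {ϖ : v.adicCompletionIntegers K}
    (hϖ : Irreducible ϖ)
    (hram : ¬ Irreducible (algebraMap (v.adicCompletionIntegers K) (w.adicCompletionIntegers L) ϖ))
    (w' : HeightOneSpectrum (NumberField.RingOfIntegers L)) (hw' : w'.asIdeal.LiesOver v.asIdeal) : w' = w := by
  have he := (Summit.Ventures.HodgeRepro2.T5RamificationIndexGlobal.not_irreducible_algebraMap_iff v w hKL hϖ).1 hram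
  rcases trichotomy v w hKL with ⟨-, -, huniq⟩ | ⟨he1, -, -⟩ | ⟨he1, -, -⟩
  · exact huniq w' hw'
  · omega
  · omega

/-- RAMIFIED ⟹ `[L_w : K_v] = 2` (quadratic `L/K`, chain language): the chain's `h2` from `hram` alone. -/
theorem finrank_eq_two_of_not_irreducible (hKL : Module.finrank K L = 2) {ϖ : v.adicCompletionIntegers K}
    (hϖ : Irreducible ϖ)
    (hram : ¬ Irreducible (algebraMap (v.adicCompletionIntegers K) (w.adicCompletionIntegers L) ϖ)) :
    Module.finrank (v.adicCompletion K) (w.adicCompletion L) = 2 := by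
  have he := (Summit.Ventures.HodgeRepro2.T5RamificationIndexGlobal.not_irreducible_algebraMap_iff v w hKL hϖ).1 hram
  rw [Summit.Ventures.HodgeRepro2.T5CompletionFundamentalIdentity.finrank_eq_ramificationIdx'_mul_inertiaDeg' v w, he]
  have hf := Summit.Ventures.HodgeRepro2.T5CompletionDegreeOne.inertiaDeg'_ne_zero v w
  have hle := ramificationIdx'_mul_inertiaDeg'_le_two v w hKL
  rw [he] at hle
  omega

/-- SPLIT ⟹ unramified: `[L_w : K_v] = 1 ⟹ Irreducible (alg ϖ)` (chain language). -/
theorem irreducible_of_finrank_eq_one {ϖ : v.adicCompletionIntegers K} (hϖ : Irreducible ϖ)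
    (h : Module.finrank (v.adicCompletion K) (w.adicCompletion L) = 1) :
    Irreducible (algebraMap (v.adicCompletionIntegers K) (w.adicCompletionIntegers L) ϖ) := by
  rw [Summit.Ventures.HodgeRepro2.T5RamificationIndexGlobal.irreducible_algebraMap_iff v w hϖ]
  exact ((Summit.Ventures.HodgeRepro2.T5CompletionDegreeOne.finrank_eq_one_iff v w).1 h).1

end Summit.Ventures.HodgeRepro2.T5QuadraticPlaceCases
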